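import Mathlib
import HarnessLib
import Summits.SmoothPoincare4.SmoothPoincare4.Theses.EntropyRung
import Literature.Geometry.Riemannian.PerelmanEntropy
import Literature.Geometry.Riemannian.RicciFlow

/-!
# Sketch — crux-ideate stmt-SmoothPoincare4-10871 (SubcylindricalExistence = ENT), ideator 1, round 1

First lemmas of three idea cards, typed over the route's fact-free vocabulary
(`PseudoRiemannianMetric`, `scalarCurvature`, `gradSq`, `dalembertian`, `ricci`, `edist`,
`riemannianMeasure`, `muEntropy`, `IsRicciFlow`).  Nothing here is filed; provable glue is proved,
analytic content is left as `Prop`s (hypotheses) or `sorry`.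
-/

open scoped Manifold ContDiff Topology ENNReal NNReal ContinuousMap
open Set Filter MeasureTheory

namespace Summit.SmoothPoincare4.SmoothPoincare4.Cruxes.SubcylindricalExistence

open Literature.Geometry.Lorentzian Literature.Geometry.Riemannian
open Summit.SmoothPoincare4.SmoothPoincare4.Theses.EntropyRung

/-- `ν_cyl = log Θ(S³×ℝ) = log 2 + ½ log π − 3/2 ≈ −0.2345`. -/
noncomputable def nuCyl : ℝ := Real.log 2 + Real.log Real.pi / 2 - 3 / 2

/-- `ν_bub = log Θ(S²×ℝ²) = log 2 − 1 ≈ −0.3069` (the bubble-sheet density). -/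
noncomputable def nuBub : ℝ := Real.log 2 - 1

section Common

variable {M : Type} [TopologicalSpace M] [T2Space M] [SecondCountableTopology M]
  [ChartedSpace (EuclideanSpace ℝ (Fin 4)) M] [IsManifold (𝓡 4) ∞ M] [T3Space M]
  [MeasurableSpace M] [BorelSpace M]

/-- The route's unfolded clause "`ν(g) > c`": `∃ δ > 0, ∀ τ > 0, ∀ f` smooth compatible,
`c + δ ≤ 𝒲(g,f,τ)` — literally the second conjunct of `SubcylindricalExistence` with the
threshold `ν_cyl` replaced by a parameter `c`. -/
def SuperEntropic (g : PseudoRiemannianMetric (𝓡 4) ∞ (EuclideanSpace ℝ (Fin 4))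
    (TangentSpace (𝓡 4) : M → Type _)) [g.HasLeviCivita] (hg : g.IsRiemannian) (c : ℝ) : Prop :=
  ∃ δ : ℝ, 0 < δ ∧ ∀ τ : ℝ, 0 < τ → ∀ f : M → ℝ, ContMDiff (𝓡 4) 𝓘(ℝ, ℝ) ∞ f →
    ∫ x, (4 * Real.pi * τ) ^ (-(4 : ℝ) / 2) * Real.exp (-f x)
        ∂(riemannianMeasure (g.toContMDiffRiemannianMetric hg)) = 1 →
      c + δ ≤ ∫ x, (τ * (g.scalarCurvature x + g.gradSq f x) + f x - 4) *
        ((4 * Real.pi * τ) ^ (-(4 : ℝ) / 2) * Real.exp (-f x))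
        ∂(riemannianMeasure (g.toContMDiffRiemannianMetric hg))

end Common

/-- Faithfulness check: ENT is "every homotopy 4-sphere carries `R > 0` and `SuperEntropic ν_cyl`". -/
theorem subcylindricalExistence_iff :
    SubcylindricalExistence ↔
      ∀ (M : Type) [TopologicalSpace M] [T2Space M] [SecondCountableTopology M]
        [ChartedSpace (EuclideanSpace ℝ (Fin 4)) M] [IsManifold (𝓡 4) ∞ M] [CompactSpace M]
        [T3Space M] [MeasurableSpace M] [BorelSpace M],
        M ≃ₕ Metric.sphere (0 : EuclideanSpace ℝ (Fin 5)) 1 →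
          ∃ g : PseudoRiemannianMetric (𝓡 4) ∞ (EuclideanSpace ℝ (Fin 4))
              (TangentSpace (𝓡 4) : M → Type _),
            ∃ _ : g.HasLeviCivita, ∃ hg : g.IsRiemannian,
              (∀ x : M, 0 < g.scalarCurvature x) ∧ SuperEntropic g hg nuCyl :=
  Iff.rfl

/-- **Scale-window lemma (common to every existence line; provable from the definition, M-sized):**
if `R ≥ R₀ > 0` on a closed 4-manifold then for `τ₀ ≥ 2/R₀` the map `τ ↦ μ(g,τ)` never drops below
`μ(g,τ₀)` on `[τ₀, ∞)`: shifting an admissible `f` at scale `τ` by the constant `2 log(τ/τ₀)` makes it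
admissible at scale `τ₀`, and `𝒲(g,f,τ) − 𝒲(g,f',τ₀) = (τ−τ₀)∫(R+|∇f|²)u − 2 log(τ/τ₀)
≥ R₀(τ−τ₀) − 2log(τ/τ₀) ≥ 0`.  Hence ENT's `∀ τ > 0` reduces, for metrics normalised to
`R ≥ 12`, to the window `τ ∈ (0, 1/6]` (and `τ → 0` is local). -/
theorem muFloor_of_scalarCurvature_ge
    {M : Type} [TopologicalSpace M] [T2Space M] [SecondCountableTopology M]
    [ChartedSpace (EuclideanSpace ℝ (Fin 4)) M] [IsManifold (𝓡 4) ∞ M] [CompactSpace M]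
    [T3Space M] [MeasurableSpace M] [BorelSpace M]
    (g : PseudoRiemannianMetric (𝓡 4) ∞ (EuclideanSpace ℝ (Fin 4))
        (TangentSpace (𝓡 4) : M → Type _)) [g.HasLeviCivita] (hg : g.IsRiemannian)
    {R₀ : ℝ} (hR₀ : 0 < R₀) (hR : ∀ x : M, R₀ ≤ g.scalarCurvature x) {c τ₀ : ℝ} (hτ₀ : 2 / R₀ ≤ τ₀)
    (h₀ : ∀ f : M → ℝ, ContMDiff (𝓡 4) 𝓘(ℝ, ℝ) ∞ f →
      ∫ x, (4 * Real.pi * τ₀) ^ (-(4 : ℝ) / 2) * Real.exp (-f x)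
          ∂(riemannianMeasure (g.toContMDiffRiemannianMetric hg)) = 1 →
        c ≤ ∫ x, (τ₀ * (g.scalarCurvature x + g.gradSq f x) + f x - 4) *
          ((4 * Real.pi * τ₀) ^ (-(4 : ℝ) / 2) * Real.exp (-f x))
          ∂(riemannianMeasure (g.toContMDiffRiemannianMetric hg)))
    {τ : ℝ} (hτ : τ₀ ≤ τ) (f : M → ℝ) (hf : ContMDiff (𝓡 4) 𝓘(ℝ, ℝ) ∞ f)
    (hcomp : ∫ x, (4 * Real.pi * τ) ^ (-(4 : ℝ) / 2) * Real.exp (-f x)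
          ∂(riemannianMeasure (g.toContMDiffRiemannianMetric hg)) = 1) :
    c ≤ ∫ x, (τ * (g.scalarCurvature x + g.gradSq f x) + f x - 4) *
          ((4 * Real.pi * τ) ^ (-(4 : ℝ) / 2) * Real.exp (-f x))
          ∂(riemannianMeasure (g.toContMDiffRiemannianMetric hg)) := by
  sorry

/-! ## Card A — `green-blowup-conformal-entropy`

Lever: the scalar-flat asymptotically Euclidean CONFORMAL BLOW-UP `h = G_p² g` of a conformal
class at a point (Schoen's Green-function metric on `Σ ∖ {p}`); its Perelman entropy
`ν_G([g],p) := ν(Σ∖p, G_p² g)` is a conformal invariant of `([g], p)`, equal to `0` (flat `ℝ⁴`)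
for the round class on `S⁴`, and ENT follows from `ν_G > ν_cyl` by a Kobayashi/Schoen gluing
`S⁴_round # ε·(Σ∖p, G²g)`.  The 𝒲-functional of `h` is written on `M` itself:
`dV_h = G⁴ dV_g`, `R_h = G⁻³ L_g G = 0`, `|∇w|²_h = G⁻² |∇w|²_g`, test functions
`u_h = (4πτ)⁻² w²`, `w ∈ C_c^∞(M ∖ {p})`. -/

section CardA

variable {M : Type} [TopologicalSpace M] [T2Space M] [SecondCountableTopology M]
  [ChartedSpace (EuclideanSpace ℝ (Fin 4)) M] [IsManifold (𝓡 4) ∞ M] [T3Space M]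
  [MeasurableSpace M] [BorelSpace M]

/-- Green blow-up data for `(g, p)`: `G` smooth and positive off `p`, `L_g G = −6 Δ_g G + R_g G
= 0` off `p` (conformal Laplacian, `n = 4`), and `G → +∞` at `p` (so, by Bôcher, `G = a Γ_p +`
bounded, `a > 0`, and `G² g` is complete, scalar-flat and AE of order 2 on `M ∖ {p}`). -/
def IsConformalGreenBlowup (g : PseudoRiemannianMetric (𝓡 4) ∞ (EuclideanSpace ℝ (Fin 4))
    (TangentSpace (𝓡 4) : M → Type _)) [g.HasLeviCivita] (p : M) (G : M → ℝ) : Prop :=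
  ContMDiffOn (𝓡 4) 𝓘(ℝ, ℝ) ∞ G {p}ᶜ ∧ (∀ x, x ≠ p → 0 < G x) ∧
    (∀ x, x ≠ p → -6 * g.dalembertian G x + g.scalarCurvature x * G x = 0) ∧
    Tendsto G (𝓝[≠] p) atTop

/-- "`ν(M∖p, G² g) > c`": Perelman's `𝒲` of the blow-up metric `h = G² g` over
`w ∈ C_c^∞(M ∖ {p})` (`u_h = (4πτ)⁻² w²`), written against `dV_g`:
`∫ (4πτ)⁻² w² G⁴ dV_g = 1 → c + δ ≤ ∫ [4τ G⁻² |∇w|²_g − w² log w² − 4 w²] (4πτ)⁻² G⁴ dV_g`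
(the term `τ R_h u_h` vanishes: `h` is scalar-flat). -/
def BlowupSuperEntropic (g : PseudoRiemannianMetric (𝓡 4) ∞ (EuclideanSpace ℝ (Fin 4))
    (TangentSpace (𝓡 4) : M → Type _)) [g.HasLeviCivita] (hg : g.IsRiemannian) (p : M)
    (G : M → ℝ) (c : ℝ) : Prop :=
  ∃ δ : ℝ, 0 < δ ∧ ∀ τ : ℝ, 0 < τ → ∀ w : M → ℝ, ContMDiff (𝓡 4) 𝓘(ℝ, ℝ) ∞ w →
    w =ᶠ[𝓝 p] 0 →
    ∫ x, (4 * Real.pi * τ) ^ (-(4 : ℝ) / 2) * (w x) ^ 2 * (G x) ^ 4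
        ∂(riemannianMeasure (g.toContMDiffRiemannianMetric hg)) = 1 →
      c + δ ≤ ∫ x, (4 * τ * ((G x)⁻¹ ^ 2 * g.gradSq w x) - (w x) ^ 2 * Real.log ((w x) ^ 2)
          - 4 * (w x) ^ 2) * ((4 * Real.pi * τ) ^ (-(4 : ℝ) / 2) * (G x) ^ 4)
        ∂(riemannianMeasure (g.toContMDiffRiemannianMetric hg))

end CardA

/-- **ENT_G (conformal blow-up existence).** Every homotopy 4-sphere carries a conformal class
and a point whose scalar-flat AE blow-up is entropically super-cylindrical at every scale. -/
def BlowupEntropyExistence : Prop :=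
  ∀ (M : Type) [TopologicalSpace M] [T2Space M] [SecondCountableTopology M]
    [ChartedSpace (EuclideanSpace ℝ (Fin 4)) M] [IsManifold (𝓡 4) ∞ M] [CompactSpace M]
    [T3Space M] [MeasurableSpace M] [BorelSpace M],
    M ≃ₕ Metric.sphere (0 : EuclideanSpace ℝ (Fin 5)) 1 →
      ∃ g : PseudoRiemannianMetric (𝓡 4) ∞ (EuclideanSpace ℝ (Fin 4))
          (TangentSpace (𝓡 4) : M → Type _),
        ∃ _ : g.HasLeviCivita, ∃ hg : g.IsRiemannian, ∃ p : M, ∃ G : M → ℝ,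
          IsConformalGreenBlowup g p G ∧ BlowupSuperEntropic g hg p G nuCyl

/-- **Green gluing lemma** (Kobayashi 1987 / Schoen 1984-type neck gluing, for `μ` instead of the
Yamabe quotient): from a super-cylindrical scalar-flat blow-up `(M∖p, G²g)` build on the closed
`M` a metric `g' = S⁴_round #_ε (M∖p, G²g)` with `R > 0` and `ν(g') > ν_cyl`
(`ν(g') ≥ min(ν(S⁴_round), ν(M∖p,G²g)) − o(1)` as `ε → 0`, `ν(S⁴_round) = log 6 − 2 > ν_cyl`,
then a small conformal change makes `R > 0` keeping the strict inequality). -/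
def GreenGluing : Prop :=
  ∀ (M : Type) [TopologicalSpace M] [T2Space M] [SecondCountableTopology M]
    [ChartedSpace (EuclideanSpace ℝ (Fin 4)) M] [IsManifold (𝓡 4) ∞ M] [CompactSpace M]
    [T3Space M] [MeasurableSpace M] [BorelSpace M],
    M ≃ₕ Metric.sphere (0 : EuclideanSpace ℝ (Fin 5)) 1 →
    ∀ (g : PseudoRiemannianMetric (𝓡 4) ∞ (EuclideanSpace ℝ (Fin 4))
        (TangentSpace (𝓡 4) : M → Type _)) [g.HasLeviCivita] (hg : g.IsRiemannian)
      (p : M) (G : M → ℝ),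
      IsConformalGreenBlowup g p G → BlowupSuperEntropic g hg p G nuCyl →
        ∃ g' : PseudoRiemannianMetric (𝓡 4) ∞ (EuclideanSpace ℝ (Fin 4))
            (TangentSpace (𝓡 4) : M → Type _),
          ∃ _ : g'.HasLeviCivita, ∃ hg' : g'.IsRiemannian,
            (∀ x : M, 0 < g'.scalarCurvature x) ∧ SuperEntropic g' hg' nuCyl

/-- **First lemma of card A (composition, proved):** ENT_G and the Green gluing lemma give ENT. -/
theorem subcylindricalExistence_of_blowup (hGlue : GreenGluing) (hE : BlowupEntropyExistence) :
    SubcylindricalExistence := by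
  intro M _ _ _ _ _ _ _ _ _ e
  obtain ⟨g, hLC, hg, p, G, hG, hν⟩ := hE M e
  exact hGlue M e g hg p G hG hν

/-- **Sanity lemma of card A (Yamabe-energy floor for CSC witnesses; provable, test `f ≡ const`,
`τ = 2/R₀`):** a constant-scalar-curvature ENT witness has `R₀² Vol(g) ≥ 128 π^{5/2} e^{1/2} e^δ`,
i.e. Yamabe energy `R₀ √Vol > 0.985 · Y(S⁴)` (`Y(S⁴)² = 384 π²`). -/
theorem yamabeEnergy_floor_of_superEntropic
    {M : Type} [TopologicalSpace M] [T2Space M] [SecondCountableTopology M]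
    [ChartedSpace (EuclideanSpace ℝ (Fin 4)) M] [IsManifold (𝓡 4) ∞ M] [CompactSpace M]
    [T3Space M] [MeasurableSpace M] [BorelSpace M] [Nonempty M]
    (g : PseudoRiemannianMetric (𝓡 4) ∞ (EuclideanSpace ℝ (Fin 4))
        (TangentSpace (𝓡 4) : M → Type _)) [g.HasLeviCivita] (hg : g.IsRiemannian)
    {R₀ δ : ℝ} (hR₀ : 0 < R₀) (hcsc : ∀ x : M, g.scalarCurvature x = R₀) (hδ : 0 < δ)
    (hν : ∀ τ : ℝ, 0 < τ → ∀ f : M → ℝ, ContMDiff (𝓡 4) 𝓘(ℝ, ℝ) ∞ f →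
      ∫ x, (4 * Real.pi * τ) ^ (-(4 : ℝ) / 2) * Real.exp (-f x)
          ∂(riemannianMeasure (g.toContMDiffRiemannianMetric hg)) = 1 →
        nuCyl + δ ≤ ∫ x, (τ * (g.scalarCurvature x + g.gradSq f x) + f x - 4) *
          ((4 * Real.pi * τ) ^ (-(4 : ℝ) / 2) * Real.exp (-f x))
          ∂(riemannianMeasure (g.toContMDiffRiemannianMetric hg))) :
    128 * Real.pi ^ ((5 : ℝ) / 2) * Real.exp (1 / 2) * Real.exp δ ≤
      R₀ ^ 2 * ((riemannianMeasure (g.toContMDiffRiemannianMetric hg)) univ).toReal := by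
  sorry

/-! ## Card B — `neck-annealing-from-bubble-floor`

Lever: Ricci flow with NECK-ONLY surgery is an entropy-raising machine: `ν(g(t))` is
non-decreasing (Perelman (T2)), a flow that ever pinches a neck has `ν ≤ ν_cyl` before, and a
component that goes extinct at a round point has `ν(g(t)) ↑ log 6 − 2 > ν_cyl`; above the
bubble-sheet density `Θ(S²×ℝ²) = 2/e` the only singularity models are necks and round points
(window gap), so from ANY `R > 0`, `ν > log 2 − 1` metric the flow-with-neck-surgery manufactures
the ENT witness on the surviving summand (and identifies the others with `S⁴`). -/

/-- **H_bub (bubble-floor existence):** ENT with the threshold lowered from `ν_cyl ≈ −0.2345` to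
`ν_bub = log Θ(S²×ℝ²) = log 2 − 1 ≈ −0.3069` (margin to the round value `0.0986` instead of
`0.0262`). -/
def BubbleFloorExistence : Prop :=
  ∀ (M : Type) [TopologicalSpace M] [T2Space M] [SecondCountableTopology M]
    [ChartedSpace (EuclideanSpace ℝ (Fin 4)) M] [IsManifold (𝓡 4) ∞ M] [CompactSpace M]
    [T3Space M] [MeasurableSpace M] [BorelSpace M],
    M ≃ₕ Metric.sphere (0 : EuclideanSpace ℝ (Fin 5)) 1 →
      ∃ g : PseudoRiemannianMetric (𝓡 4) ∞ (EuclideanSpace ℝ (Fin 4))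
          (TangentSpace (𝓡 4) : M → Type _),
        ∃ _ : g.HasLeviCivita, ∃ hg : g.IsRiemannian,
          (∀ x : M, 0 < g.scalarCurvature x) ∧ SuperEntropic g hg nuBub

/-- **Neck-window gap** (typed like `NoncompactShrinkerGap`, on the wider window): a complete
non-compact non-flat normalised 4-d gradient shrinker with Gaussian density `> Θ(S²×ℝ²) = 2/e`,
i.e. `∫ e^{−f} dV > 32π²/e`, has density exactly `Θ(S³×ℝ)`, i.e. `∫ e^{−f} dV = 32π²√π e^{−3/2}`
(the only models in `(2/e, 1)` are the cylinder — and its quotients, which are `< 2/e`). -/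
def NeckWindowGap : Prop :=
  ∀ (M : Type) [TopologicalSpace M] [T2Space M] [SecondCountableTopology M]
    [ChartedSpace (EuclideanSpace ℝ (Fin 4)) M] [IsManifold (𝓡 4) ∞ M] [ConnectedSpace M]
    [NoncompactSpace M] [T3Space M] [MeasurableSpace M] [BorelSpace M]
    (g : PseudoRiemannianMetric (𝓡 4) ∞ (EuclideanSpace ℝ (Fin 4))
      (TangentSpace (𝓡 4) : M → Type _)) [g.HasLeviCivita] (f : M → ℝ) (hg : g.IsRiemannian),
    (∀ (x : M) (r : NNReal), IsCompact {y : M | g.edist hg x y ≤ r}) →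
    ContMDiff (𝓡 4) 𝓘(ℝ, ℝ) ∞ f →
    (∀ (x : M) (X Y : TangentSpace (𝓡 4) x),
      g.ricci x X Y + g.hessian f x X Y = (1 / 2 : ℝ) * g.val x X Y) →
    (∀ x : M, g.scalarCurvature x + g.gradSq f x = f x) → (∃ x : M, g.scalarCurvature x ≠ 0) →
    ENNReal.ofReal (32 * Real.pi ^ 2 * Real.exp (-1)) <
      ∫⁻ x, ENNReal.ofReal (Real.exp (-f x))
        ∂(riemannianMeasure (g.toContMDiffRiemannianMetric hg)) →
    ∫⁻ x, ENNReal.ofReal (Real.exp (-f x)) ∂(riemannianMeasure (g.toContMDiffRiemannianMetric hg))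
      = ENNReal.ofReal (32 * Real.pi ^ 2 * Real.sqrt Real.pi * Real.exp (-(3 : ℝ) / 2))

/-- **Neck annealing (the engine; informal content: Ricci flow with surgery at necks only, entropy
bookkeeping through surgery, round extinction):** on a homotopy 4-sphere an `R > 0`,
`ν > ν_bub` metric can be improved to an `R > 0`, `ν > ν_cyl` metric.  Deliberately stated per
manifold; its proof is where `NeckWindowGap`, (T2), the surgery-entropy lemma and
`CompactShrinkerGap` enter. -/
def NeckAnnealing : Prop :=
  ∀ (M : Type) [TopologicalSpace M] [T2Space M] [SecondCountableTopology M]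
    [ChartedSpace (EuclideanSpace ℝ (Fin 4)) M] [IsManifold (𝓡 4) ∞ M] [CompactSpace M]
    [T3Space M] [MeasurableSpace M] [BorelSpace M],
    M ≃ₕ Metric.sphere (0 : EuclideanSpace ℝ (Fin 5)) 1 →
    ∀ (g : PseudoRiemannianMetric (𝓡 4) ∞ (EuclideanSpace ℝ (Fin 4))
        (TangentSpace (𝓡 4) : M → Type _)) [g.HasLeviCivita] (hg : g.IsRiemannian),
      (∀ x : M, 0 < g.scalarCurvature x) → SuperEntropic g hg nuBub →
        ∃ g' : PseudoRiemannianMetric (𝓡 4) ∞ (EuclideanSpace ℝ (Fin 4))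
            (TangentSpace (𝓡 4) : M → Type _),
          ∃ _ : g'.HasLeviCivita, ∃ hg' : g'.IsRiemannian,
            (∀ x : M, 0 < g'.scalarCurvature x) ∧ SuperEntropic g' hg' nuCyl

/-- **Composition for card B (proved).** -/
theorem subcylindricalExistence_of_annealing (hA : NeckAnnealing) (hB : BubbleFloorExistence) :
    SubcylindricalExistence := by
  intro M _ _ _ _ _ _ _ _ _ e
  obtain ⟨g, hLC, hg, hR, hν⟩ := hB M e
  exact hA M e g hg hR hν

/-- **First cog of card B (proved from Perelman's (T2), in the tree's shape
`perelman_noLocalCollapsing_of_muMonotone`):** an entropy floor valid at all scales persists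
forward along a smooth Ricci flow on a closed manifold — `ν(g(t))` is non-decreasing. -/
theorem muFloor_persists
    (T2 : ∀ {E : Type} [NormedAddCommGroup E] [NormedSpace ℝ E] [FiniteDimensional ℝ E]
      {H : Type} [TopologicalSpace H] (I : ModelWithCorners ℝ E H) [I.Boundaryless]
      (M : Type) [TopologicalSpace M] [T2Space M] [SecondCountableTopology M] [CompactSpace M]
      [ChartedSpace H M] [IsManifold I ∞ M] [MeasurableSpace M] [BorelSpace M] (T' : ℝ), 0 < T' →
      ∀ (g : ℝ → PseudoRiemannianMetric I ∞ E (TangentSpace I : M → Type _))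
        (cov : ℝ → CovariantDerivative I E (TangentSpace I : M → Type _)),
        IsRicciFlow g cov (Icc 0 T') → (∀ t ∈ Icc 0 T', (g t).IsRiemannian) →
          ∀ τ : ℝ, 0 < τ → (g 0).muEntropy (cov 0) (τ + T') ≤ (g T').muEntropy (cov T') τ)
    {M : Type} [TopologicalSpace M] [T2Space M] [SecondCountableTopology M] [CompactSpace M]
    [ChartedSpace (EuclideanSpace ℝ (Fin 4)) M] [IsManifold (𝓡 4) ∞ M]
    [MeasurableSpace M] [BorelSpace M]
    (g : ℝ → PseudoRiemannianMetric (𝓡 4) ∞ (EuclideanSpace ℝ (Fin 4))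
      (TangentSpace (𝓡 4) : M → Type _))
    (cov : ℝ → CovariantDerivative (𝓡 4) (EuclideanSpace ℝ (Fin 4))
      (TangentSpace (𝓡 4) : M → Type _))
    {T' : ℝ} (hT' : 0 < T') (hflow : IsRicciFlow g cov (Icc 0 T'))
    (hRiem : ∀ t ∈ Icc 0 T', (g t).IsRiemannian) {c : EReal}
    (h0 : ∀ τ : ℝ, 0 < τ → c ≤ (g 0).muEntropy (cov 0) τ) :
    ∀ τ : ℝ, 0 < τ → c ≤ (g T').muEntropy (cov T') τ := by
  intro τ hτ
  exact (h0 (τ + T') (by linarith)).trans (T2 (𝓡 4) M T' hT' g cov hflow hRiem τ hτ)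

/-! ## Card C — `fat-conical-core-avr-logsobolev`

Lever: the SHARP AVR-weighted log-Sobolev inequality on complete `Ric ≥ 0` manifolds with asymptotic
volume ratio `θ` (Balogh–Kristály–Tripaldi 2022, Thm. 1.1, `p = 2`, `N = n = 4`, built on the
Balogh–Kristály / Brendle sharp isoperimetric inequality) gives `μ(h,τ) ≥ log θ` at EVERY scale with no loss; so ENT follows from a
complete `Ric ≥ 0` metric on the punctured homotopy sphere with `θ > Θ(S³×ℝ) = 2√π e^{−3/2}`
plus a conical gluing lemma. -/

/-- **AVR entropy floor** (Balogh–Kristály–Tripaldi arXiv:2210.15774 Thm. 1.1 with `p = 2`, `N = 4`: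
`∫u²log u² ≤ (N/2) log(𝓛_{2,N} AVR^{-2/N} ∫|∇u|²)` = Euclidean sharp LSI `+ log(1/θ)`; in 𝒲-normalisation,
after optimising the scale, `𝒲 ≥ log θ`; the `τ R u` term dropped since `R ≥ 0`): complete non-compact `(P⁴,h)`, `Ric ≥ 0`, asymptotic volume
ratio `θ > 0` (`Vol B_r(x) / (π²r⁴/2) → θ`) ⇒ for all `τ > 0` and `w ∈ C_c^∞(P)` with
`∫ (4πτ)⁻² w² = 1`: `log θ ≤ ∫ [4τ|∇w|² − w² log w² − 4w²](4πτ)⁻² dV_h`. -/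
def AVREntropyFloor : Prop :=
  ∀ (P : Type) [TopologicalSpace P] [T2Space P] [SecondCountableTopology P]
    [ChartedSpace (EuclideanSpace ℝ (Fin 4)) P] [IsManifold (𝓡 4) ∞ P] [NoncompactSpace P]
    [T3Space P] [MeasurableSpace P] [BorelSpace P]
    (h : PseudoRiemannianMetric (𝓡 4) ∞ (EuclideanSpace ℝ (Fin 4))
      (TangentSpace (𝓡 4) : P → Type _)) [h.HasLeviCivita] (hh : h.IsRiemannian) (θ : ℝ),
    (∀ (x : P) (r : NNReal), IsCompact {y : P | h.edist hh x y ≤ r}) →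
    (∀ (x : P) (X : TangentSpace (𝓡 4) x), 0 ≤ h.ricci x X X) → 0 < θ →
    (∀ x : P, Tendsto (fun r : ℝ ↦
        ((riemannianMeasure (h.toContMDiffRiemannianMetric hh))
            {y : P | h.edist hh x y ≤ ENNReal.ofReal r}).toReal / (Real.pi ^ 2 / 2 * r ^ 4))
        atTop (𝓝 θ)) →
    ∀ τ : ℝ, 0 < τ → ∀ w : P → ℝ, ContMDiff (𝓡 4) 𝓘(ℝ, ℝ) ∞ w → HasCompactSupport w →
      ∫ x, (4 * Real.pi * τ) ^ (-(4 : ℝ) / 2) * (w x) ^ 2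
          ∂(riemannianMeasure (h.toContMDiffRiemannianMetric hh)) = 1 →
        Real.log θ ≤ ∫ x, (4 * τ * h.gradSq w x - (w x) ^ 2 * Real.log ((w x) ^ 2)
            - 4 * (w x) ^ 2) * (4 * Real.pi * τ) ^ (-(4 : ℝ) / 2)
          ∂(riemannianMeasure (h.toContMDiffRiemannianMetric hh))

/-- **Fat conical core existence (the transferred crux C⁺ of card C):** the punctured homotopy
sphere `M ∖ {p}` (presented as an abstract `P` with a smooth open embedding onto `{p}ᶜ`, so that
`P` carries exactly the smooth structure of `Σ°`) admits a complete `Ric ≥ 0` metric with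
asymptotic volume ratio `θ > Θ(S³×ℝ) = 2√π e^{−3/2} ≈ 0.791`. -/
def FatConicalCoreExistence : Prop :=
  ∀ (M : Type) [TopologicalSpace M] [T2Space M] [SecondCountableTopology M]
    [ChartedSpace (EuclideanSpace ℝ (Fin 4)) M] [IsManifold (𝓡 4) ∞ M] [CompactSpace M]
    [T3Space M] [MeasurableSpace M] [BorelSpace M],
    M ≃ₕ Metric.sphere (0 : EuclideanSpace ℝ (Fin 5)) 1 →
    ∃ (p : M) (P : Type) (_ : TopologicalSpace P) (_ : T2Space P) (_ : SecondCountableTopology P)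
      (_ : ChartedSpace (EuclideanSpace ℝ (Fin 4)) P) (_ : IsManifold (𝓡 4) ∞ P)
      (_ : NoncompactSpace P) (_ : T3Space P) (_ : MeasurableSpace P) (_ : BorelSpace P)
      (ι : P → M),
      (Topology.IsOpenEmbedding ι ∧ ContMDiff (𝓡 4) (𝓡 4) ∞ ι ∧
        (∀ x : P, Function.Injective (mfderiv (𝓡 4) (𝓡 4) ι x)) ∧ Set.range ι = {p}ᶜ) ∧
      ∃ h : PseudoRiemannianMetric (𝓡 4) ∞ (EuclideanSpace ℝ (Fin 4))
          (TangentSpace (𝓡 4) : P → Type _),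
        ∃ _ : h.HasLeviCivita, ∃ hh : h.IsRiemannian, ∃ θ : ℝ,
          (∀ (x : P) (r : NNReal), IsCompact {y : P | h.edist hh x y ≤ r}) ∧
          (∀ (x : P) (X : TangentSpace (𝓡 4) x), 0 ≤ h.ricci x X X) ∧
          2 * Real.sqrt Real.pi * Real.exp (-(3 : ℝ) / 2) < θ ∧
          (∀ x : P, Tendsto (fun r : ℝ ↦
            ((riemannianMeasure (h.toContMDiffRiemannianMetric hh))
              {y : P | h.edist hh x y ≤ ENNReal.ofReal r}).toReal / (Real.pi ^ 2 / 2 * r ^ 4))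
            atTop (𝓝 θ))

/-- **Conical gluing lemma (card C's analytic stub):** given the AVR entropy floor, a fat conical
`Ric ≥ 0` core on `M ∖ {p}` can be capped off (truncate the cone end at radius `ρ → ∞`, glue a
large spherical cap with `R > 0`) into a closed metric on `M` with `R > 0` and `ν > ν_cyl`. -/
def ConicalGluing : Prop :=
  AVREntropyFloor → FatConicalCoreExistence → SubcylindricalExistence

/-- **Composition for card C (trivial by design; the content is in the two stubs).** -/
theorem subcylindricalExistence_of_conicalCore (hB : AVREntropyFloor) (hG : ConicalGluing)
    (hC : FatConicalCoreExistence) : SubcylindricalExistence :=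
  hG hB hC

end Summit.SmoothPoincare4.SmoothPoincare4.Cruxes.SubcylindricalExistence
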